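import Literature.MathematicalPhysics.QuantumFieldTheory.Balaban1983to89.B4Sect5Proof

/-!
# `Balaban1983to89.B9Eq387CubeReductionClosedWindows` — T. Bałaban, *Propagators for lattice gauge theories in a background field*, Commun. Math. Phys. **99**
# (1985) 389–434 [Balaban1985BackgroundPropagators] Cor. 3.6 p. 408, (3.87)–(3.89) p. 409 («for cubes □ of a size O(1)M … M sufficiently large»), Thm 3.11
# p. 416 («a small neighbourhood of the identity»): **THE SCALAR WINDOWS OF THE CLOSED PER-CUBE (loc) ESTIMATE ARE ADMISSIBLE — collar radii `r₀, R` chosen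
# from the constants alone make the (β)-window number `ε_E(r₀, R, β₂) ≤ t` for every `0 ≤ β₂ ≤ 2` (it is `A·e^{−κr₀/2} + B(β₂)∕R`), and a plaquette
# smallness `δ ≤ δ₀(N₁)` makes the auxiliary background's `ε̃ = N₁·δ` fall below any finite list of positive thresholds** — the real-analysis half of this
# lineage's `B9Eq387CubeReductionClosed.cube_loc_closed` ((K10); its displayed windows (W1)(W1′)(W2)(W3)), kept on `B4Sect5Proof` + Mathlib so that it
# elaborates independently of the chain's operator files; route R2′ STEP B8′, instance-ledger row L10 of the pub-balaban NE9 chain (`t4/ROUTES-NE9.md` v13.46)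

statement-level skeleton of published theorems with citation tags; proofs where landed; nothing here is a claim about the Yang–Mills mass gap

CITATION HEADER (lean-in-tree rule).  Audit cell `pub-balaban`, sub-cell `t4`, BINDER row NE9; filed by NE9 formalisation-swarm LEAF PROVER 05
(`b2b-balaban-t4-ne9-formalise-leaf-05`, gen 79).  [folklore] elementary real analysis (`Real.add_one_le_exp`, the archimedean property); the window
expression is `B9Eq389CubeLocalisedProjectionWindowAdjoint.exists_window_hcmp`'s printed `ε` VERBATIM (its letters `C`, `latticeConst (d+1) (κ∕2)`, `M_φ`,
`M_φ′`, `ε₁`, `β₂`, `r₀`, `R`).  Source READ: [Balaban1985BackgroundPropagators] p. 409 (3.87)–(3.89) («for cubes of a size O(1)M … M sufficiently large» —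
the role of the collar radii), p. 416 Thm 3.11 («small neighbourhood»).  Print's own numbers are NOT these: the thresholds below are the ROUTE's bookkeeping, NOT
OPTIMISED (Bernoulli-type and `1 + x ≤ e^x` bounds), NOTHING of [B9]'s constants is asserted.

WHY ((K10)'s HONEST RESIDUE).  `cube_loc_closed` is closed UP TO four displayed scalar windows: (W1) `ε̃ ≤ ε₂`, (W1′) `ε̃ ≤ ε_reg`, (W2) `ε̃ ≤ ε₁` and (W3)
`ε_E ≤ 1 ∧ 3ε_EM_D² ≤ γ∕2`, where `ε̃ = |L(Nc+3)|₁·δ` and `ε_E = ε_E(r₀, R, 2ε̃)`.  This file shows they are jointly satisfiable with the quantifier order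
(K10) needs — `r₀, R` BEFORE the cube extent and `δ`, `δ₀` AFTER the cube extent — so that «(loc) for the (3.35) class» holds with `∃ r₀ R, ∀ Nc, ∃ δ₀ > 0`.

WHAT IS PROVED (sorry-free; proof lane — no `def`; [folklore]).
* §1 `exists_radii` (`A, B ≥ 0`, `κ, t > 0` ⊢ `∃ r₀ R ∈ ℕ_{>0}`, `A·e^{−κr₀∕2} + B∕R ≤ t`); private `le_threshold_of_le` (`N₁δ ≤ θ` once `0 ≤ δ ≤ θ∕(N₁ + 1)`).
* §2 **`epsE_le`** — for `β₂ ≤ β`, `R > 0`: `ε_E(r₀, R, β₂) ≤ C·latticeConst·e^{−κr₀∕2} + B(β)∕R` with the explicit `R`-free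
  `B(β) = √(d+1)·L(M_φM_φ′+1)·s + ((d+1)·2L² + P·(K₁ + (d+1)3^{d+1}L²M_φ′M_φ(2β + 4ε₁²) + K₃)·P_ε·(d+1)·L)·s²` (`s = (√(1∕8))⁻¹`,
  `P = (1 − 3^{d+1}(P_ε − 1))⁻¹`, `P_ε = (1 + 2M_φM_φ′ε₁)^{(d+1)(L−1)}`); `epsE_nonneg` (`0 ≤ ε_E` for `β₂ ≥ 0`).
* §3 **`exists_radii_epsE`** — `∃ r₀ R ∈ ℕ_{>0}` with `ε_E(r₀, R, β₂) ≤ t` for EVERY `0 ≤ β₂ ≤ 2`, any target `t > 0`; private `three_mul_target_mul_sq_le`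
  (`3·(γ∕(2(3M²+1)))·M² ≤ γ∕2`); **`windows_admissible`** — given `γ, ε₂, θ₀, θ₁ > 0`, `ε₁ ∈ (0, 1]`, `κ > 0`, `C ≥ 0`, `M_φ, M_φ′ ≥ 0`, the profile
  letter `< 1`, any `M_D : ℝ`: `∃ r₀ R ∈ ℕ_{>0}, ∀ N₁ : ℕ, ∃ δ₀ > 0, ∀ δ ∈ [0, δ₀]`:
  `δ ≤ θ₀` (any fixed `θ₀ > 0`, e.g. (K10)'s `hδr` threshold), `N₁δ ≤ ε₂`, `N₁δ ≤ θ₁` (any `θ₁ > 0`, e.g. `ε_reg`), `N₁δ ≤ ε₁`, `ε_E(r₀, R, 2N₁δ) ≤ 1` and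
  `3·ε_E·M_D² ≤ γ∕2` — (K10)'s (W1)(W1′)(W2)(W3) and `hδr` at `N₁ := |L(Nc+3)|₁` (`l1`, an `ℕ`), `M_D := 2√(d+1)·(‖η⁻¹‖·(1+1))`.
HONEST SCOPE.  Scalar side conditions only — no operator, no lattice; existence by the archimedean property, NOT a closed-form `r₀, R, δ₀` (each is a `⌈·⌉`-type
choice inside the proof; a closed form is an optional sequel); the SIZES these windows allow (row L10's NEEDS-CONSTANT `γ₀(κ₁, d, L)`) are untouched.  NOT NE9
(cell pub-balaban: NE9 NOT PRINTED ∕ NOT PROVED; «NE9 ⇐ the named binders»; row WALLED ON A MODEL (O-NE9-1; #5 UNRULED); spine PROVED 0∕9; rung (B)+1 on a finite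
T⁴ — NOT infinite volume, NOT mass gap, NOT BetaPertH, NOT Clay; HONEST DEPENDENCY: continuum YM on T⁴ ⇐ BetaPertH ∧ nine spine estimates (0/9 proved); BetaPertH
⇐ (D1) ∧ (D4) ∧ CAP+tail; G-an2-4 gates asym, D1 and NE2/3/4).  NEW file; imports `B4Sect5Proof` only; nothing modified.  Net new unproved facts: 0.
-/

noncomputable section

set_option autoImplicit false

namespace Literature.MathematicalPhysics.QuantumFieldTheory.Balaban1983to89.B9Eq387CubeReductionClosedWindows

open B4Sect5Proof (latticeConst latticeConst_nonneg)

/-! ## §1 Radii and thresholds -/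

/-- **RADII**: for `A, B ≥ 0`, `κ > 0`, `t > 0` there are natural numbers `r₀, R > 0` with `A·e^{−κr₀∕2} + B∕R ≤ t` (`1 + x ≤ e^x` and the archimedean
property). [folklore] [cite: Balaban1985BackgroundPropagators, (3.87)–(3.89) p.409] -/
theorem exists_radii {A B κ t : ℝ} (hA : 0 ≤ A) (hB : 0 ≤ B) (hκ : 0 < κ) (ht : 0 < t) :
    ∃ r₀ R : ℕ, 0 < r₀ ∧ 0 < R ∧ A * Real.exp (-(κ / 2 * (r₀ : ℝ))) + B / (R : ℝ) ≤ t := by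
  obtain ⟨R, hR⟩ := exists_nat_gt (2 * B / t)
  obtain ⟨r₀, hr₀⟩ := exists_nat_gt (4 * A / (t * κ))
  have hRpos : (0 : ℝ) < R := lt_of_le_of_lt (by positivity) hR
  have hr₀pos : (0 : ℝ) < r₀ := lt_of_le_of_lt (by positivity) hr₀
  refine ⟨r₀, R, by exact_mod_cast hr₀pos, by exact_mod_cast hRpos, ?_⟩
  have h1 : B / (R : ℝ) ≤ t / 2 := by
    rw [div_le_iff₀ hRpos]
    have := (div_lt_iff₀ ht).1 hR
    linarith
  have h2 : A * Real.exp (-(κ / 2 * (r₀ : ℝ))) ≤ t / 2 := by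
    have he : κ / 2 * (r₀ : ℝ) + 1 ≤ Real.exp (κ / 2 * (r₀ : ℝ)) := Real.add_one_le_exp _
    have hepos : 0 < Real.exp (κ / 2 * (r₀ : ℝ)) := Real.exp_pos _
    rw [Real.exp_neg, ← div_eq_mul_inv, div_le_iff₀ hepos]
    have h3 : 4 * A < (r₀ : ℝ) * (t * κ) := (div_lt_iff₀ (by positivity)).1 hr₀
    nlinarith
  linarith

/-- **THRESHOLDS**: `N₁·δ ≤ θ` whenever `0 ≤ δ ≤ θ∕(N₁ + 1)`. [folklore] -/
private theorem le_threshold_of_le {θ δ : ℝ} (N₁ : ℕ) (hδ0 : 0 ≤ δ) (hδ : δ ≤ θ / ((N₁ : ℝ) + 1)) : (N₁ : ℝ) * δ ≤ θ := by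
  have hN : (0 : ℝ) < (N₁ : ℝ) + 1 := by positivity
  have h1 : (N₁ : ℝ) * δ ≤ ((N₁ : ℝ) + 1) * δ := by nlinarith
  have h2 : ((N₁ : ℝ) + 1) * δ ≤ ((N₁ : ℝ) + 1) * (θ / ((N₁ : ℝ) + 1)) := mul_le_mul_of_nonneg_left hδ hN.le
  rw [mul_div_cancel₀ _ hN.ne'] at h2
  linarith

/-! ## §2 The (β)-window number `ε_E(r₀, R, β₂)`: non-negative, affine in `1∕R`, monotone in `β₂` -/

section EpsE

variable {d L : ℕ} {C κ Mφ Mφ' ε₁ : ℝ} (hC : 0 ≤ C) (hκ : 0 < κ) (hMφ : 0 ≤ Mφ) (hMφ' : 0 ≤ Mφ') (hε₁ : 0 ≤ ε₁)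
  (hq : 3 ^ (d + 1) * ((1 + 2 * Mφ * Mφ' * ε₁) ^ ((d + 1) * (L - 1)) - 1) < 1)

include hC hκ hMφ hMφ' hε₁ hq in
/-- **`0 ≤ ε_E(r₀, R, β₂)`** for `β₂ ≥ 0` (every summand non-negative; the profile factor `(1 − 3^{d+1}(P_ε − 1))⁻¹ > 0` by the letter `hq`).
[folklore] [cite: Balaban1985BackgroundPropagators, Cor 3.6 p.408] -/
theorem epsE_nonneg {β₂ : ℝ} (hβ : 0 ≤ β₂) (r₀ R : ℕ) :
    0 ≤ (C * latticeConst (d + 1) (κ / 2) * Real.exp (-(κ / 2 * (r₀ : ℝ))) +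
      Real.sqrt ((d + 1 : ℕ) : ℝ) * ((L : ℝ) / (R : ℝ) * (Mφ * Mφ' + 1)) * (Real.sqrt (1 / 8))⁻¹ +
      (((d + 1 : ℕ) : ℝ) * (2 * (L : ℝ) ^ 2 / (R : ℝ)) +
        ((1 - 3 ^ (d + 1) * ((1 + 2 * Mφ * Mφ' * ε₁) ^ ((d + 1) * (L - 1)) - 1))⁻¹ *
          ((d + 1 : ℕ) * (3 / 2 : ℝ) ^ (d + 1) * (9 * Real.pi ^ 2) * 2 ^ (d + 1 - 1) +
            (d + 1 : ℕ) * 3 ^ (d + 1) * ((L : ℝ) ^ 2 * (Mφ' * Mφ * (2 * β₂ + 4 * ε₁ ^ 2))) +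
            (d + 1 : ℕ) * (3 / 2 : ℝ) ^ (d + 1) * (6 * Real.pi) * 2 ^ (d + 1 - 1) * ((L : ℝ) * (2 * Mφ * Mφ' * ε₁)))) *
        ((1 + 2 * Mφ * Mφ' * ε₁) ^ ((d + 1) * (L - 1)) * (((d + 1 : ℕ) : ℝ) * ((L : ℝ) / (R : ℝ))))) * ((Real.sqrt (1 / 8))⁻¹) ^ 2) := by
  have hq' : 0 < 1 - 3 ^ (d + 1) * ((1 + 2 * Mφ * Mφ' * ε₁) ^ ((d + 1) * (L - 1)) - 1) := by linarith
  have hlc : 0 ≤ latticeConst (d + 1) (κ / 2) := latticeConst_nonneg (d + 1) (by positivity)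
  generalize hP : (1 - 3 ^ (d + 1) * ((1 + 2 * Mφ * Mφ' * ε₁) ^ ((d + 1) * (L - 1)) - 1))⁻¹ = P at *
  have hP0 : 0 < P := by rw [← hP]; exact inv_pos.mpr hq'
  generalize hLC : latticeConst (d + 1) (κ / 2) = LC at *
  generalize hPE : (1 + 2 * Mφ * Mφ' * ε₁) ^ ((d + 1) * (L - 1)) = PE at *
  have hPE0 : 0 ≤ PE := by rw [← hPE]; positivity
  positivity

include hMφ hMφ' hε₁ hq in
/-- **`ε_E(r₀, R, β₂) ≤ C·latticeConst·e^{−κr₀∕2} + B(β)∕R`** for `β₂ ≤ β` and `R > 0`, with the explicit `R`-free `B(β)` displayed in the statement: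
the window number is affine in `1∕R` and non-decreasing in `β₂` (for `0 ≤ β₂ ≤ β`; only `β₂ ≤ β` is used). [folklore] [cite: Balaban1985BackgroundPropagators, Cor 3.6 p.408, (3.87)–(3.89) p.409] -/
theorem epsE_le {β₂ β : ℝ} (hβ : β₂ ≤ β) (r₀ : ℕ) {R : ℕ} (hR : 0 < R) :
    (C * latticeConst (d + 1) (κ / 2) * Real.exp (-(κ / 2 * (r₀ : ℝ))) +
      Real.sqrt ((d + 1 : ℕ) : ℝ) * ((L : ℝ) / (R : ℝ) * (Mφ * Mφ' + 1)) * (Real.sqrt (1 / 8))⁻¹ +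
      (((d + 1 : ℕ) : ℝ) * (2 * (L : ℝ) ^ 2 / (R : ℝ)) +
        ((1 - 3 ^ (d + 1) * ((1 + 2 * Mφ * Mφ' * ε₁) ^ ((d + 1) * (L - 1)) - 1))⁻¹ *
          ((d + 1 : ℕ) * (3 / 2 : ℝ) ^ (d + 1) * (9 * Real.pi ^ 2) * 2 ^ (d + 1 - 1) +
            (d + 1 : ℕ) * 3 ^ (d + 1) * ((L : ℝ) ^ 2 * (Mφ' * Mφ * (2 * β₂ + 4 * ε₁ ^ 2))) +
            (d + 1 : ℕ) * (3 / 2 : ℝ) ^ (d + 1) * (6 * Real.pi) * 2 ^ (d + 1 - 1) * ((L : ℝ) * (2 * Mφ * Mφ' * ε₁)))) *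
        ((1 + 2 * Mφ * Mφ' * ε₁) ^ ((d + 1) * (L - 1)) * (((d + 1 : ℕ) : ℝ) * ((L : ℝ) / (R : ℝ))))) * ((Real.sqrt (1 / 8))⁻¹) ^ 2) ≤
    C * latticeConst (d + 1) (κ / 2) * Real.exp (-(κ / 2 * (r₀ : ℝ))) +
      (Real.sqrt ((d + 1 : ℕ) : ℝ) * ((L : ℝ) * (Mφ * Mφ' + 1)) * (Real.sqrt (1 / 8))⁻¹ +
        (((d + 1 : ℕ) : ℝ) * (2 * (L : ℝ) ^ 2) +
          ((1 - 3 ^ (d + 1) * ((1 + 2 * Mφ * Mφ' * ε₁) ^ ((d + 1) * (L - 1)) - 1))⁻¹ *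
            ((d + 1 : ℕ) * (3 / 2 : ℝ) ^ (d + 1) * (9 * Real.pi ^ 2) * 2 ^ (d + 1 - 1) +
              (d + 1 : ℕ) * 3 ^ (d + 1) * ((L : ℝ) ^ 2 * (Mφ' * Mφ * (2 * β + 4 * ε₁ ^ 2))) +
              (d + 1 : ℕ) * (3 / 2 : ℝ) ^ (d + 1) * (6 * Real.pi) * 2 ^ (d + 1 - 1) * ((L : ℝ) * (2 * Mφ * Mφ' * ε₁)))) *
          ((1 + 2 * Mφ * Mφ' * ε₁) ^ ((d + 1) * (L - 1)) * (((d + 1 : ℕ) : ℝ) * (L : ℝ)))) * ((Real.sqrt (1 / 8))⁻¹) ^ 2) / (R : ℝ) := by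
  have hq' : 0 < 1 - 3 ^ (d + 1) * ((1 + 2 * Mφ * Mφ' * ε₁) ^ ((d + 1) * (L - 1)) - 1) := by linarith
  have hRr : (0 : ℝ) < R := by exact_mod_cast hR
  have hP0 : 0 ≤ (1 - 3 ^ (d + 1) * ((1 + 2 * Mφ * Mφ' * ε₁) ^ ((d + 1) * (L - 1)) - 1))⁻¹ := (inv_pos.mpr hq').le
  have hPE0 : 0 ≤ (1 + 2 * Mφ * Mφ' * ε₁) ^ ((d + 1) * (L - 1)) := by positivity
  -- monotone in `β₂` (the only `β₂`-term has a non-negative coefficient)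
  have hmono : (1 - 3 ^ (d + 1) * ((1 + 2 * Mφ * Mφ' * ε₁) ^ ((d + 1) * (L - 1)) - 1))⁻¹ *
          ((d + 1 : ℕ) * (3 / 2 : ℝ) ^ (d + 1) * (9 * Real.pi ^ 2) * 2 ^ (d + 1 - 1) +
            (d + 1 : ℕ) * 3 ^ (d + 1) * ((L : ℝ) ^ 2 * (Mφ' * Mφ * (2 * β₂ + 4 * ε₁ ^ 2))) +
            (d + 1 : ℕ) * (3 / 2 : ℝ) ^ (d + 1) * (6 * Real.pi) * 2 ^ (d + 1 - 1) * ((L : ℝ) * (2 * Mφ * Mφ' * ε₁))) *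
        ((1 + 2 * Mφ * Mφ' * ε₁) ^ ((d + 1) * (L - 1)) * (((d + 1 : ℕ) : ℝ) * ((L : ℝ) / (R : ℝ)))) ≤
      (1 - 3 ^ (d + 1) * ((1 + 2 * Mφ * Mφ' * ε₁) ^ ((d + 1) * (L - 1)) - 1))⁻¹ *
          ((d + 1 : ℕ) * (3 / 2 : ℝ) ^ (d + 1) * (9 * Real.pi ^ 2) * 2 ^ (d + 1 - 1) +
            (d + 1 : ℕ) * 3 ^ (d + 1) * ((L : ℝ) ^ 2 * (Mφ' * Mφ * (2 * β + 4 * ε₁ ^ 2))) +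
            (d + 1 : ℕ) * (3 / 2 : ℝ) ^ (d + 1) * (6 * Real.pi) * 2 ^ (d + 1 - 1) * ((L : ℝ) * (2 * Mφ * Mφ' * ε₁))) *
        ((1 + 2 * Mφ * Mφ' * ε₁) ^ ((d + 1) * (L - 1)) * (((d + 1 : ℕ) : ℝ) * ((L : ℝ) / (R : ℝ)))) := by
    apply mul_le_mul_of_nonneg_right _ (by positivity)
    apply mul_le_mul_of_nonneg_left _ hP0
    have : (d + 1 : ℕ) * 3 ^ (d + 1) * ((L : ℝ) ^ 2 * (Mφ' * Mφ * (2 * β₂ + 4 * ε₁ ^ 2))) ≤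
        (d + 1 : ℕ) * 3 ^ (d + 1) * ((L : ℝ) ^ 2 * (Mφ' * Mφ * (2 * β + 4 * ε₁ ^ 2))) := by
      apply mul_le_mul_of_nonneg_left _ (by positivity)
      apply mul_le_mul_of_nonneg_left _ (by positivity)
      apply mul_le_mul_of_nonneg_left _ (by positivity)
      linarith
    linarith
  have hs0 : 0 ≤ ((Real.sqrt (1 / 8))⁻¹) ^ 2 := by positivity
  -- affine in `1/R`: the right-hand side at `β` is the left-hand side's shape with `β₂ := β`
  have hkey : (C * latticeConst (d + 1) (κ / 2) * Real.exp (-(κ / 2 * (r₀ : ℝ))) +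
      Real.sqrt ((d + 1 : ℕ) : ℝ) * ((L : ℝ) / (R : ℝ) * (Mφ * Mφ' + 1)) * (Real.sqrt (1 / 8))⁻¹ +
      (((d + 1 : ℕ) : ℝ) * (2 * (L : ℝ) ^ 2 / (R : ℝ)) +
        ((1 - 3 ^ (d + 1) * ((1 + 2 * Mφ * Mφ' * ε₁) ^ ((d + 1) * (L - 1)) - 1))⁻¹ *
          ((d + 1 : ℕ) * (3 / 2 : ℝ) ^ (d + 1) * (9 * Real.pi ^ 2) * 2 ^ (d + 1 - 1) +
            (d + 1 : ℕ) * 3 ^ (d + 1) * ((L : ℝ) ^ 2 * (Mφ' * Mφ * (2 * β + 4 * ε₁ ^ 2))) +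
            (d + 1 : ℕ) * (3 / 2 : ℝ) ^ (d + 1) * (6 * Real.pi) * 2 ^ (d + 1 - 1) * ((L : ℝ) * (2 * Mφ * Mφ' * ε₁)))) *
        ((1 + 2 * Mφ * Mφ' * ε₁) ^ ((d + 1) * (L - 1)) * (((d + 1 : ℕ) : ℝ) * ((L : ℝ) / (R : ℝ))))) * ((Real.sqrt (1 / 8))⁻¹) ^ 2) =
    C * latticeConst (d + 1) (κ / 2) * Real.exp (-(κ / 2 * (r₀ : ℝ))) +
      (Real.sqrt ((d + 1 : ℕ) : ℝ) * ((L : ℝ) * (Mφ * Mφ' + 1)) * (Real.sqrt (1 / 8))⁻¹ +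
        (((d + 1 : ℕ) : ℝ) * (2 * (L : ℝ) ^ 2) +
          ((1 - 3 ^ (d + 1) * ((1 + 2 * Mφ * Mφ' * ε₁) ^ ((d + 1) * (L - 1)) - 1))⁻¹ *
            ((d + 1 : ℕ) * (3 / 2 : ℝ) ^ (d + 1) * (9 * Real.pi ^ 2) * 2 ^ (d + 1 - 1) +
              (d + 1 : ℕ) * 3 ^ (d + 1) * ((L : ℝ) ^ 2 * (Mφ' * Mφ * (2 * β + 4 * ε₁ ^ 2))) +
              (d + 1 : ℕ) * (3 / 2 : ℝ) ^ (d + 1) * (6 * Real.pi) * 2 ^ (d + 1 - 1) * ((L : ℝ) * (2 * Mφ * Mφ' * ε₁)))) *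
          ((1 + 2 * Mφ * Mφ' * ε₁) ^ ((d + 1) * (L - 1)) * (((d + 1 : ℕ) : ℝ) * (L : ℝ)))) * ((Real.sqrt (1 / 8))⁻¹) ^ 2) / (R : ℝ) := by
    simp only [div_eq_mul_inv]
    ring
  have hmono' := mul_le_mul_of_nonneg_right (add_le_add_left hmono (((d + 1 : ℕ) : ℝ) * (2 * (L : ℝ) ^ 2 / (R : ℝ)))) hs0
  linarith [hmono', hkey.le]

end EpsE

/-! ## §3 Admissibility of (K10)'s windows -/

section Admissible

variable {d L : ℕ} {C κ Mφ Mφ' ε₁ : ℝ} (hC : 0 ≤ C) (hκ : 0 < κ) (hMφ : 0 ≤ Mφ) (hMφ' : 0 ≤ Mφ') (hε₁ : 0 ≤ ε₁)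
  (hq : 3 ^ (d + 1) * ((1 + 2 * Mφ * Mφ' * ε₁) ^ ((d + 1) * (L - 1)) - 1) < 1)

include hC hκ hMφ hMφ' hε₁ hq in
/-- **COLLAR RADII FOR ANY TARGET**: `∃ r₀ R ∈ ℕ_{>0}` such that `ε_E(r₀, R, β₂) ≤ t` for EVERY `0 ≤ β₂ ≤ 2` — the radii depend on the constants and
`t` only (cube extent and `δ` come later). [folklore] [cite: Balaban1985BackgroundPropagators, (3.87)–(3.89) p.409 «for cubes of a size O(1)M»] -/
theorem exists_radii_epsE {t : ℝ} (ht : 0 < t) :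
    ∃ r₀ R : ℕ, 0 < r₀ ∧ 0 < R ∧ ∀ β₂ : ℝ, 0 ≤ β₂ → β₂ ≤ 2 →
      (C * latticeConst (d + 1) (κ / 2) * Real.exp (-(κ / 2 * (r₀ : ℝ))) +
        Real.sqrt ((d + 1 : ℕ) : ℝ) * ((L : ℝ) / (R : ℝ) * (Mφ * Mφ' + 1)) * (Real.sqrt (1 / 8))⁻¹ +
        (((d + 1 : ℕ) : ℝ) * (2 * (L : ℝ) ^ 2 / (R : ℝ)) +
          ((1 - 3 ^ (d + 1) * ((1 + 2 * Mφ * Mφ' * ε₁) ^ ((d + 1) * (L - 1)) - 1))⁻¹ *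
            ((d + 1 : ℕ) * (3 / 2 : ℝ) ^ (d + 1) * (9 * Real.pi ^ 2) * 2 ^ (d + 1 - 1) +
              (d + 1 : ℕ) * 3 ^ (d + 1) * ((L : ℝ) ^ 2 * (Mφ' * Mφ * (2 * β₂ + 4 * ε₁ ^ 2))) +
              (d + 1 : ℕ) * (3 / 2 : ℝ) ^ (d + 1) * (6 * Real.pi) * 2 ^ (d + 1 - 1) * ((L : ℝ) * (2 * Mφ * Mφ' * ε₁)))) *
          ((1 + 2 * Mφ * Mφ' * ε₁) ^ ((d + 1) * (L - 1)) * (((d + 1 : ℕ) : ℝ) * ((L : ℝ) / (R : ℝ))))) * ((Real.sqrt (1 / 8))⁻¹) ^ 2) ≤ t := by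
  have hq' : 0 < 1 - 3 ^ (d + 1) * ((1 + 2 * Mφ * Mφ' * ε₁) ^ ((d + 1) * (L - 1)) - 1) := by linarith
  have hA : 0 ≤ C * latticeConst (d + 1) (κ / 2) := mul_nonneg hC (latticeConst_nonneg (d + 1) (by positivity))
  have hB : 0 ≤ Real.sqrt ((d + 1 : ℕ) : ℝ) * ((L : ℝ) * (Mφ * Mφ' + 1)) * (Real.sqrt (1 / 8))⁻¹ +
      (((d + 1 : ℕ) : ℝ) * (2 * (L : ℝ) ^ 2) +
        ((1 - 3 ^ (d + 1) * ((1 + 2 * Mφ * Mφ' * ε₁) ^ ((d + 1) * (L - 1)) - 1))⁻¹ *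
          ((d + 1 : ℕ) * (3 / 2 : ℝ) ^ (d + 1) * (9 * Real.pi ^ 2) * 2 ^ (d + 1 - 1) +
            (d + 1 : ℕ) * 3 ^ (d + 1) * ((L : ℝ) ^ 2 * (Mφ' * Mφ * (2 * 2 + 4 * ε₁ ^ 2))) +
            (d + 1 : ℕ) * (3 / 2 : ℝ) ^ (d + 1) * (6 * Real.pi) * 2 ^ (d + 1 - 1) * ((L : ℝ) * (2 * Mφ * Mφ' * ε₁)))) *
        ((1 + 2 * Mφ * Mφ' * ε₁) ^ ((d + 1) * (L - 1)) * (((d + 1 : ℕ) : ℝ) * (L : ℝ)))) * ((Real.sqrt (1 / 8))⁻¹) ^ 2 := by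
    generalize hP : (1 - 3 ^ (d + 1) * ((1 + 2 * Mφ * Mφ' * ε₁) ^ ((d + 1) * (L - 1)) - 1))⁻¹ = P at *
    have hP0 : 0 < P := by rw [← hP]; exact inv_pos.mpr hq'
    generalize hPE : (1 + 2 * Mφ * Mφ' * ε₁) ^ ((d + 1) * (L - 1)) = PE at *
    have hPE0 : 0 ≤ PE := by rw [← hPE]; positivity
    positivity
  obtain ⟨r₀, R, hr₀, hR, h⟩ := exists_radii (A := C * latticeConst (d + 1) (κ / 2)) (κ := κ) hA hB hκ ht
  refine ⟨r₀, R, hr₀, hR, fun β₂ hβ0 hβ2 => ?_⟩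
  exact (epsE_le (d := d) (L := L) (C := C) (κ := κ) hMφ hMφ' hε₁ hq hβ2 r₀ hR).trans h

/-- `3 · (γ ∕ (2(3M² + 1))) · M² ≤ γ∕2` for `γ > 0`: the choice of the `ε_E`-target behind (W3). [folklore] -/
private theorem three_mul_target_mul_sq_le {γ : ℝ} (hγ : 0 < γ) (M : ℝ) : 3 * (γ / (2 * (3 * M ^ 2 + 1))) * M ^ 2 ≤ γ / 2 := by
  have hX : (0 : ℝ) < 2 * (3 * M ^ 2 + 1) := by positivity
  have hinv : 0 ≤ (2 * (3 * M ^ 2 + 1))⁻¹ := inv_nonneg.mpr hX.le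
  have hone : (2 * (3 * M ^ 2 + 1)) * (2 * (3 * M ^ 2 + 1))⁻¹ = 1 := mul_inv_cancel₀ hX.ne'
  have h1 : 3 * M ^ 2 * (2 * (3 * M ^ 2 + 1))⁻¹ ≤ 1 / 2 := by
    nlinarith [mul_le_mul_of_nonneg_right (show 3 * M ^ 2 ≤ 3 * M ^ 2 + 1 by linarith) hinv]
  rw [div_eq_mul_inv]
  nlinarith [mul_le_mul_of_nonneg_left h1 hγ.le]

include hC hκ hMφ hMφ' hε₁ hq in
/-- **(K10)'s WINDOWS ARE ADMISSIBLE.**  Given SC's `γ, ε₂ > 0`, (β)'s `ε₁ ∈ (0, 1]`, `κ > 0`, `C ≥ 0`, the profile letter `hq`, the divergence bound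
`M_D`, and any two further positive thresholds `θ₀, θ₁` (for `hδr` and `ε_reg`): `∃ r₀ R ∈ ℕ_{>0}` (collar radii) such that for EVERY `N₁ : ℕ` (the
weight `|L(Nc+3)|₁` of the cube's box) `∃ δ₀ > 0` with: every `0 ≤ δ ≤ δ₀` satisfies `δ ≤ θ₀`, `N₁δ ≤ ε₂`, `N₁δ ≤ θ₁`, `N₁δ ≤ ε₁`,
`ε_E(r₀, R, 2N₁δ) ≤ 1` and `3·ε_E(r₀, R, 2N₁δ)·M_D² ≤ γ∕2` — the binders `hδr`, (W1), (W1′), (W2), (W3) of `B9Eq387CubeReductionClosed.cube_loc_closed`.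
[folklore] [cite: Balaban1985BackgroundPropagators, Cor 3.6 p.408, (3.87)–(3.89) p.409, Thm 3.11 p.416] -/
theorem windows_admissible (hε₁1 : ε₁ ≤ 1) {γ ε₂ θ₀ θ₁ MD : ℝ} (hγ : 0 < γ) (hε₂ : 0 < ε₂) (hθ₀ : 0 < θ₀) (hθ₁ : 0 < θ₁) (hε₁0 : 0 < ε₁) :
    ∃ r₀ R : ℕ, 0 < r₀ ∧ 0 < R ∧ ∀ N₁ : ℕ, ∃ δ₀ : ℝ, 0 < δ₀ ∧ ∀ δ : ℝ, 0 ≤ δ → δ ≤ δ₀ →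
      δ ≤ θ₀ ∧ (N₁ : ℝ) * δ ≤ ε₂ ∧ (N₁ : ℝ) * δ ≤ θ₁ ∧ (N₁ : ℝ) * δ ≤ ε₁ ∧
      (C * latticeConst (d + 1) (κ / 2) * Real.exp (-(κ / 2 * (r₀ : ℝ))) +
        Real.sqrt ((d + 1 : ℕ) : ℝ) * ((L : ℝ) / (R : ℝ) * (Mφ * Mφ' + 1)) * (Real.sqrt (1 / 8))⁻¹ +
        (((d + 1 : ℕ) : ℝ) * (2 * (L : ℝ) ^ 2 / (R : ℝ)) +
          ((1 - 3 ^ (d + 1) * ((1 + 2 * Mφ * Mφ' * ε₁) ^ ((d + 1) * (L - 1)) - 1))⁻¹ *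
            ((d + 1 : ℕ) * (3 / 2 : ℝ) ^ (d + 1) * (9 * Real.pi ^ 2) * 2 ^ (d + 1 - 1) +
              (d + 1 : ℕ) * 3 ^ (d + 1) * ((L : ℝ) ^ 2 * (Mφ' * Mφ * (2 * (2 * ((N₁ : ℝ) * δ)) + 4 * ε₁ ^ 2))) +
              (d + 1 : ℕ) * (3 / 2 : ℝ) ^ (d + 1) * (6 * Real.pi) * 2 ^ (d + 1 - 1) * ((L : ℝ) * (2 * Mφ * Mφ' * ε₁)))) *
          ((1 + 2 * Mφ * Mφ' * ε₁) ^ ((d + 1) * (L - 1)) * (((d + 1 : ℕ) : ℝ) * ((L : ℝ) / (R : ℝ))))) * ((Real.sqrt (1 / 8))⁻¹) ^ 2) ≤ 1 ∧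
      3 * (C * latticeConst (d + 1) (κ / 2) * Real.exp (-(κ / 2 * (r₀ : ℝ))) +
        Real.sqrt ((d + 1 : ℕ) : ℝ) * ((L : ℝ) / (R : ℝ) * (Mφ * Mφ' + 1)) * (Real.sqrt (1 / 8))⁻¹ +
        (((d + 1 : ℕ) : ℝ) * (2 * (L : ℝ) ^ 2 / (R : ℝ)) +
          ((1 - 3 ^ (d + 1) * ((1 + 2 * Mφ * Mφ' * ε₁) ^ ((d + 1) * (L - 1)) - 1))⁻¹ *
            ((d + 1 : ℕ) * (3 / 2 : ℝ) ^ (d + 1) * (9 * Real.pi ^ 2) * 2 ^ (d + 1 - 1) +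
              (d + 1 : ℕ) * 3 ^ (d + 1) * ((L : ℝ) ^ 2 * (Mφ' * Mφ * (2 * (2 * ((N₁ : ℝ) * δ)) + 4 * ε₁ ^ 2))) +
              (d + 1 : ℕ) * (3 / 2 : ℝ) ^ (d + 1) * (6 * Real.pi) * 2 ^ (d + 1 - 1) * ((L : ℝ) * (2 * Mφ * Mφ' * ε₁)))) *
          ((1 + 2 * Mφ * Mφ' * ε₁) ^ ((d + 1) * (L - 1)) * (((d + 1 : ℕ) : ℝ) * ((L : ℝ) / (R : ℝ))))) * ((Real.sqrt (1 / 8))⁻¹) ^ 2) *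
        MD ^ 2 ≤ γ / 2 := by
  -- the target for `ε_E`: `t := min 1 (γ / (2 (3 M_D² + 1)))`
  have hM : (0 : ℝ) < 3 * MD ^ 2 + 1 := by positivity
  have ht : 0 < min (1 : ℝ) (γ / (2 * (3 * MD ^ 2 + 1))) := lt_min one_pos (by positivity)
  obtain ⟨r₀, R, hr₀, hR, hE⟩ := exists_radii_epsE (d := d) (L := L) hC hκ hMφ hMφ' hε₁ hq ht
  refine ⟨r₀, R, hr₀, hR, fun N₁ => ?_⟩
  -- the plaquette threshold for this cube weight
  refine ⟨min θ₀ (min ε₂ (min θ₁ ε₁)) / ((N₁ : ℝ) + 1), by positivity, fun δ hδ0 hδ => ?_⟩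
  have hN : (0 : ℝ) < (N₁ : ℝ) + 1 := by positivity
  have hm0 : min θ₀ (min ε₂ (min θ₁ ε₁)) ≤ θ₀ := min_le_left _ _
  have hm2 : min θ₀ (min ε₂ (min θ₁ ε₁)) ≤ ε₂ := (min_le_right _ _).trans (min_le_left _ _)
  have hm1 : min θ₀ (min ε₂ (min θ₁ ε₁)) ≤ θ₁ := (min_le_right _ _).trans ((min_le_right _ _).trans (min_le_left _ _))
  have hme : min θ₀ (min ε₂ (min θ₁ ε₁)) ≤ ε₁ := (min_le_right _ _).trans ((min_le_right _ _).trans (min_le_right _ _))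
  have hmin0 : 0 ≤ min θ₀ (min ε₂ (min θ₁ ε₁)) := le_min hθ₀.le (le_min hε₂.le (le_min hθ₁.le hε₁0.le))
  have hδθ₀ : δ ≤ θ₀ := by
    have h1 : min θ₀ (min ε₂ (min θ₁ ε₁)) / ((N₁ : ℝ) + 1) ≤ min θ₀ (min ε₂ (min θ₁ ε₁)) := div_le_self hmin0 (by linarith)
    linarith
  have hw2 : (N₁ : ℝ) * δ ≤ ε₂ := le_threshold_of_le N₁ hδ0 (hδ.trans (div_le_div_of_nonneg_right hm2 hN.le))
  have hw1 : (N₁ : ℝ) * δ ≤ θ₁ := le_threshold_of_le N₁ hδ0 (hδ.trans (div_le_div_of_nonneg_right hm1 hN.le))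
  have hwe : (N₁ : ℝ) * δ ≤ ε₁ := le_threshold_of_le N₁ hδ0 (hδ.trans (div_le_div_of_nonneg_right hme hN.le))
  have hβ0 : 0 ≤ 2 * ((N₁ : ℝ) * δ) := by positivity
  have hβ2 : 2 * ((N₁ : ℝ) * δ) ≤ 2 := by linarith
  have hEβ := hE (2 * ((N₁ : ℝ) * δ)) hβ0 hβ2
  have hE1 := hEβ.trans (min_le_left _ _)
  have hEγ := hEβ.trans (min_le_right _ _)
  refine ⟨hδθ₀, hw2, hw1, hwe, hE1, ?_⟩
  -- `3 ε_E M_D² ≤ γ/2` from `ε_E ≤ γ / (2 (3 M_D² + 1))`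
  have key := three_mul_target_mul_sq_le hγ MD
  have h3 := mul_le_mul_of_nonneg_right hEγ (sq_nonneg MD)
  clear hE hEβ hE1 hEγ
  linarith [h3, key]

end Admissible

end Literature.MathematicalPhysics.QuantumFieldTheory.Balaban1983to89.B9Eq387CubeReductionClosedWindows

end
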